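import Summits.CriticalPhenomena.PercolationContinuityZ3.Theorems.PercNearOneGluingNoHeavyLowerTailSuffices
import Summits.CriticalPhenomena.PercolationContinuityZ3.Theorems.PercNearOneGluingNoHeavyLowerTailLonelyRelay
import HarnessLib

/-!
# `NoHeavyLowerTail` (crux stmt-CriticalPhenomena-4575) — DOWNSTREAM of the `|A| = 5` one-cut rung:
# what `oneCut(5)` gives at `|A| ≤ 5`, and what the crux "at `|A| = 5`" does NOT contain

Support file (prover seat `prim-a5-assembly-2`, the downstream half of the `|A| = 5` assembly, `--supports
stmt-CriticalPhenomena-4575`; companion of assembly-1's `…OneCutFiveAssembly`, see `run/shared/lean/prim/prim-a5/ASSEMBLY.md`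
§8a).  No definitions, no named facts, no sorries; every hypothesis is written VERBATIM in the shape of the registered
stub `stub_oneCut` (so the file does not depend on the order in which the two assembly files land).

SETTING.  `μ = prodBernoulli w` on `Fin n`, observer `o`, relay set `A`, `N = #{a ∈ A : o ↔ a}`, `E N = Σ_{a∈A} μ(o ↔ a)`.
`oneCut(5)` := `stub_oneCut` at `A.card = 5`: for every `t ≥ 0` bounding all relay–relay cuts `μ(a ↮ a')` (`a ≠ a' ∈ A`),
`μ{1 ≤ N < E N/2} ≤ t`.  PROVED rungs in the tree: `oneCut_card_le_four` (`|A| ≤ 4`), `oneCut5_le_six` (`|A| = 5`, `n ≤ 6`).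

THEOREMS.
* `OneCutDownstream.linearGluing_of_oneCutAt` — INSTANCE-WISE: if the one-cut bound holds at `(w, A, o)` then for every
  target `b` and every `δ ≥ max_{a∈A} μ(a ↮ b)`:  `1 − μ(o ↔ b) ≤ (1 − μ(o ↔ A)) + 4δ`.  (Kozma–Nitzan near-one gluing in LINEAR
  form with the `|A|`-free constant `4`: pairwise cuts `≤ 2δ` by the union bound `nhlts_pair`; cover `nhlts_cover` at threshold
  `E N/2`; Harris + Markov tail `nhlts_tail` gives `μ(N ≥ E N/2, o ↮ b) ≤ 2δ`.)  The union bound alone gives the constant `|A|`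
  (`gluing_unionBound`), so the one-cut bound improves on it exactly from `|A| = 5` on.
* `OneCutDownstream.oneCut_card_le_five_of_oneCut5`, `…lowerTail_card_le_five_of_oneCut5`,
  `…linearGluing_card_le_five_of_oneCut5` — `oneCut(5)` (all graphs) + the tree's rungs `|A| ≤ 4` ⟹ for every relay set with
  `A.card ≤ 5`: the one-cut bound, the lower-tail bound `μ{1 ≤ N < E N/2} ≤ 2·max_a μ(a ↮ b)`, and linear gluing with constant 4.
* `OneCutDownstream.noHeavyLowerTail_restricted_card_le`, `…nearOneGluing_restricted_card_le` — KERNEL REMARK (trivial regime):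
  the ε–δ statements of the crux `NoHeavyLowerTail` and of `NearOneGluing` RESTRICTED to `A.card ≤ k` hold unconditionally for
  every `k` (`δ := ε/(k+1)`: the lower-tail event is empty, resp. the union bound).  So "the crux at `|A| = 5`" carries no
  information; the `|A| = 5` content of the programme lives only in the constant-carrying forms above (constant `1` in
  `oneCut(5)`, constant `4` independent of `|A|` in the gluing inequality).

NOT USED, on purpose (ASSEMBLY.md §1–§4, §8): SHK3⁺ (`ThreePointLB.sahiE3_pairSep_nonneg`), E1 (`hybridSepRow_holds`), the E3GRP
rows (`E3GroupSepCert.RowHolds`) — their dependency DAG in the tree sinks at SHK3⁺ and has no edge to the one-cut ladder.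
HONEST LABEL: toward `|A| = 5` of the one-arm near-critical percolation programme (crux 4575); `oneCut(5)` is OPEN for `n ≥ 7`;
nothing here asserts it or the crux.
-/

noncomputable section

namespace Summit.CriticalPhenomena.PercolationContinuityZ3.Theorems

namespace OneCutDownstream

open MeasureTheory Set Literature.Probability.LatticeModels Literature.Probability.Percolation
open scoped Classical BigOperators

/-! ## Union-bound gluing (the trivial constant `|A|·δ`, for comparison and for the trivial regime) -/

/-- **Cover for gluing through a relay set**: `{o ↮ b} ⊆ {o ↮ A} ∪ ⋃_{a∈A} {a ↮ b}`, in measure: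
`1 − μ(o ↔ b) ≤ (1 − μ(o ↔ A)) + Σ_{a∈A} μ(a ↮ b)`. [folklore] -/
theorem gluing_unionBound_sum {n : ℕ} (w : Sym2 (Fin n) → unitInterval) (A : Finset (Fin n)) (o b : Fin n) :
    1 - (prodBernoulli w).real (openConn o b : Set (BondConfig (Fin n))) ≤
      (1 - (prodBernoulli w).real (⋃ a ∈ A, (openConn o a : Set (BondConfig (Fin n))))) +
        ∑ a ∈ A, (prodBernoulli w).real (openConn a b : Set (BondConfig (Fin n)))ᶜ := by
  set μ := prodBernoulli w with hμ
  have hmeas : ∀ s : Set (BondConfig (Fin n)), MeasurableSet s := fun _ => MeasurableSet.of_discrete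
  have hcov : (openConn o b : Set (BondConfig (Fin n)))ᶜ ⊆
      (⋃ a ∈ A, (openConn o a : Set (BondConfig (Fin n))))ᶜ ∪
        ⋃ a ∈ A, (openConn a b : Set (BondConfig (Fin n)))ᶜ := by
    intro ω hω
    by_cases hU : ω ∈ ⋃ a ∈ A, (openConn o a : Set (BondConfig (Fin n)))
    · right
      obtain ⟨a, ha, hoa⟩ := Set.mem_iUnion₂.1 hU
      refine Set.mem_iUnion₂.2 ⟨a, ha, ?_⟩
      intro hab
      have hoa' : (openGraph ω).Reachable o a := hoa
      have hab' : (openGraph ω).Reachable a b := hab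
      exact hω (hoa'.trans hab')
    · left; exact hU
  have h1 : μ.real (openConn o b : Set (BondConfig (Fin n)))ᶜ =
      1 - μ.real (openConn o b : Set (BondConfig (Fin n))) := probReal_compl_eq_one_sub (hmeas _)
  have h2 : μ.real (⋃ a ∈ A, (openConn o a : Set (BondConfig (Fin n))))ᶜ =
      1 - μ.real (⋃ a ∈ A, (openConn o a : Set (BondConfig (Fin n)))) := probReal_compl_eq_one_sub (hmeas _)
  calc 1 - μ.real (openConn o b : Set (BondConfig (Fin n)))
      = μ.real (openConn o b : Set (BondConfig (Fin n)))ᶜ := h1.symm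
    _ ≤ μ.real ((⋃ a ∈ A, (openConn o a : Set (BondConfig (Fin n))))ᶜ ∪
          ⋃ a ∈ A, (openConn a b : Set (BondConfig (Fin n)))ᶜ) := measureReal_mono hcov
    _ ≤ μ.real (⋃ a ∈ A, (openConn o a : Set (BondConfig (Fin n))))ᶜ +
          μ.real (⋃ a ∈ A, (openConn a b : Set (BondConfig (Fin n)))ᶜ) := measureReal_union_le _ _
    _ ≤ μ.real (⋃ a ∈ A, (openConn o a : Set (BondConfig (Fin n))))ᶜ +
          ∑ a ∈ A, μ.real (openConn a b : Set (BondConfig (Fin n)))ᶜ := by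
        gcongr
        exact measureReal_biUnion_finset_le A fun a => (openConn a b : Set (BondConfig (Fin n)))ᶜ
    _ = _ := by rw [h2]

/-- **Union-bound gluing with constant `|A|`**: if `μ(a ↮ b) ≤ δ` for all `a ∈ A` then
`1 − μ(o ↔ b) ≤ (1 − μ(o ↔ A)) + |A|·δ`. [folklore] -/
theorem gluing_unionBound {n : ℕ} (w : Sym2 (Fin n) → unitInterval) (A : Finset (Fin n)) (o b : Fin n)
    (δ : ℝ) (hAb : ∀ a ∈ A, (prodBernoulli w).real (openConn a b : Set (BondConfig (Fin n)))ᶜ ≤ δ) :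
    1 - (prodBernoulli w).real (openConn o b : Set (BondConfig (Fin n))) ≤
      (1 - (prodBernoulli w).real (⋃ a ∈ A, (openConn o a : Set (BondConfig (Fin n))))) + A.card * δ := by
  have h := gluing_unionBound_sum w A o b
  have hs : ∑ a ∈ A, (prodBernoulli w).real (openConn a b : Set (BondConfig (Fin n)))ᶜ ≤ ∑ _a ∈ A, δ :=
    Finset.sum_le_sum fun a ha => hAb a ha
  rw [Finset.sum_const, nsmul_eq_mul] at hs
  linarith

/-! ## The one-cut bound at one instance ⟹ linear near-one gluing with the `|A|`-free constant 4 -/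

/-- **One-cut ⟹ linear gluing, instance-wise.**  If at `(w, A, o)` the one-cut bound holds (for every `t ≥ 0`
bounding all relay–relay cuts, `μ{1 ≤ N < E N/2} ≤ t`), then for every target `b` and every `δ ≥ 0` with
`μ(a ↮ b) ≤ δ` for all `a ∈ A`:  `1 − μ(o ↔ b) ≤ (1 − μ(o ↔ A)) + 4δ`.
Proof: cuts `μ(a ↮ a') ≤ μ(a ↮ b) + μ(a' ↮ b) ≤ 2δ` (`nhlts_pair`); cover at threshold `E N/2` (`nhlts_cover`);
Harris–Markov tail `(E N/2)·μ(N ≥ E N/2, o ↮ b) ≤ δ·E N` (`nhlts_tail`); the case `E N = 0` is the union bound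
`μ(o ↔ A) ≤ E N = 0`. [this work] -/
theorem linearGluing_of_oneCutAt {n : ℕ} (w : Sym2 (Fin n) → unitInterval) (A : Finset (Fin n)) (o b : Fin n)
    (δ : ℝ) (hδ : 0 ≤ δ)
    (hcut : ∀ t : ℝ, 0 ≤ t →
      (∀ a ∈ A, ∀ a' ∈ A, a ≠ a' →
        (prodBernoulli w).real (openConn a a' : Set (BondConfig (Fin n)))ᶜ ≤ t) →
      (prodBernoulli w).real {ω : BondConfig (Fin n) |
          1 ≤ (A.filter fun a => ω ∈ openConn o a).card ∧
          ((A.filter fun a => ω ∈ openConn o a).card : ℝ) <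
            (∑ a ∈ A, (prodBernoulli w).real (openConn o a : Set (BondConfig (Fin n)))) / 2} ≤ t)
    (hAb : ∀ a ∈ A, (prodBernoulli w).real (openConn a b : Set (BondConfig (Fin n)))ᶜ ≤ δ) :
    1 - (prodBernoulli w).real (openConn o b : Set (BondConfig (Fin n))) ≤
      (1 - (prodBernoulli w).real (⋃ a ∈ A, (openConn o a : Set (BondConfig (Fin n))))) + 4 * δ := by
  set μ := prodBernoulli w with hμ
  have hmeas : ∀ s : Set (BondConfig (Fin n)), MeasurableSet s := fun _ => MeasurableSet.of_discrete
  obtain ⟨S, hS⟩ : ∃ S : ℝ, ∑ a ∈ A, μ.real (openConn o a : Set (BondConfig (Fin n))) = S := ⟨_, rfl⟩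
  have hS0 : 0 ≤ S := hS ▸ Finset.sum_nonneg fun a _ => measureReal_nonneg
  have hob0 : 0 ≤ μ.real (openConn o b : Set (BondConfig (Fin n))) := measureReal_nonneg
  -- `μ(a ↔ b) ≥ 1 − δ` for all relays
  have hAb' : ∀ a ∈ A, 1 - δ ≤ μ.real (openConn a b : Set (BondConfig (Fin n))) := by
    intro a ha
    have hc : μ.real (openConn a b : Set (BondConfig (Fin n)))ᶜ =
        1 - μ.real (openConn a b : Set (BondConfig (Fin n))) := probReal_compl_eq_one_sub (hmeas _)
    have := hAb a ha
    rw [hc] at this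
    linarith
  -- degenerate case `E N = 0`: union bound `μ(o ↔ A) ≤ E N`
  rcases hS0.eq_or_lt with hS00 | hSpos
  · have hUle : μ.real (⋃ a ∈ A, (openConn o a : Set (BondConfig (Fin n)))) ≤
        ∑ a ∈ A, μ.real (openConn o a : Set (BondConfig (Fin n))) :=
      measureReal_biUnion_finset_le A fun a => (openConn o a : Set (BondConfig (Fin n)))
    rw [hS, ← hS00] at hUle
    have h1 : μ.real (openConn o b : Set (BondConfig (Fin n))) ≤ 1 := measureReal_le_one
    nlinarith
  -- pairwise cuts among relays are `≤ 2δ`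
  have hpair : ∀ a ∈ A, ∀ a' ∈ A, a ≠ a' →
      μ.real (openConn a a' : Set (BondConfig (Fin n)))ᶜ ≤ 2 * δ := by
    intro a ha a' ha' _
    have hp := nhlts_pair w a a' b
    have hc : μ.real (openConn a a' : Set (BondConfig (Fin n)))ᶜ =
        1 - μ.real (openConn a a' : Set (BondConfig (Fin n))) := probReal_compl_eq_one_sub (hmeas _)
    rw [hc]
    linarith [hAb' a ha, hAb' a' ha']
  have hmid := hcut (2 * δ) (by positivity) hpair
  rw [hS] at hmid
  have hcov := nhlts_cover w A o b (S / 2)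
  have htail := nhlts_tail w A o b δ (S / 2) hAb'
  rw [hS] at htail
  obtain ⟨M, hM⟩ : ∃ M : ℝ, μ.real
      ({ω | S / 2 ≤ ((A.filter fun a => ω ∈ openConn o a).card : ℝ)} ∩
        (openConn o b : Set (BondConfig (Fin n)))ᶜ) = M := ⟨_, rfl⟩
  rw [hM] at hcov htail
  -- tail: `(S/2)·M ≤ δ·S` with `S > 0` gives `M ≤ 2δ`
  have hMle : M ≤ 2 * δ := by
    by_contra hcon
    push Not at hcon
    have h1 : S / 2 * (2 * δ) < S / 2 * M := mul_lt_mul_of_pos_left hcon (by positivity)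
    have h2 : S / 2 * (2 * δ) = δ * S := by ring
    linarith
  linarith

/-! ## `oneCut(5)` for all graphs ⟹ the rung for every `A.card ≤ 5`, the lower-tail form, and linear gluing -/

/-- **`oneCut(5)` ⟹ the one-cut bound for every relay set with at most five relays** (the rungs `|A| ≤ 4` are the tree's
`oneCut_card_le_four`). [this work] -/
theorem oneCut_card_le_five_of_oneCut5
    (h5 : ∀ (n : ℕ) (w : Sym2 (Fin n) → unitInterval) (A : Finset (Fin n)) (o : Fin n) (t : ℝ), A.card = 5 → 0 ≤ t →
      (∀ a ∈ A, ∀ a' ∈ A, a ≠ a' →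
        (Literature.Probability.LatticeModels.prodBernoulli w).real
          (Literature.Probability.Percolation.openConn a a')ᶜ ≤ t) →
      (Literature.Probability.LatticeModels.prodBernoulli w).real
        {ω : Literature.Probability.Percolation.BondConfig (Fin n) |
          1 ≤ (A.filter fun a => ω ∈ Literature.Probability.Percolation.openConn o a).card ∧
          ((A.filter fun a => ω ∈ Literature.Probability.Percolation.openConn o a).card : ℝ) <
            (∑ a ∈ A, (Literature.Probability.LatticeModels.prodBernoulli w).real
              (Literature.Probability.Percolation.openConn o a)) / 2} ≤ t) :
    ∀ (n : ℕ) (w : Sym2 (Fin n) → unitInterval) (A : Finset (Fin n)) (o : Fin n) (t : ℝ), A.card ≤ 5 → 0 ≤ t →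
      (∀ a ∈ A, ∀ a' ∈ A, a ≠ a' →
        (Literature.Probability.LatticeModels.prodBernoulli w).real
          (Literature.Probability.Percolation.openConn a a')ᶜ ≤ t) →
      (Literature.Probability.LatticeModels.prodBernoulli w).real
        {ω : Literature.Probability.Percolation.BondConfig (Fin n) |
          1 ≤ (A.filter fun a => ω ∈ Literature.Probability.Percolation.openConn o a).card ∧
          ((A.filter fun a => ω ∈ Literature.Probability.Percolation.openConn o a).card : ℝ) <
            (∑ a ∈ A, (Literature.Probability.LatticeModels.prodBernoulli w).real
              (Literature.Probability.Percolation.openConn o a)) / 2} ≤ t := by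
  intro n w A o t hA ht hpair
  rcases Nat.lt_or_ge A.card 5 with hlt | hge
  · exact oneCut_card_le_four n w A o t (by omega) ht hpair
  · exact h5 n w A o t (le_antisymm hA hge) ht hpair

/-- **`oneCut(5)` ⟹ the lower-tail bound at `|A| ≤ 5` in terms of a common target `b`**: if `μ(a ↮ b) ≤ δ` for all
`a ∈ A` (`|A| ≤ 5`), then `μ{1 ≤ N < E N/2} ≤ 2δ` (pairwise cuts `≤ 2δ` by `nhlts_pair`).  This is the `|A| ≤ 5`,
constant-carrying form of the crux's event bound. [this work] -/
theorem lowerTail_card_le_five_of_oneCut5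
    (h5 : ∀ (n : ℕ) (w : Sym2 (Fin n) → unitInterval) (A : Finset (Fin n)) (o : Fin n) (t : ℝ), A.card = 5 → 0 ≤ t →
      (∀ a ∈ A, ∀ a' ∈ A, a ≠ a' →
        (Literature.Probability.LatticeModels.prodBernoulli w).real
          (Literature.Probability.Percolation.openConn a a')ᶜ ≤ t) →
      (Literature.Probability.LatticeModels.prodBernoulli w).real
        {ω : Literature.Probability.Percolation.BondConfig (Fin n) |
          1 ≤ (A.filter fun a => ω ∈ Literature.Probability.Percolation.openConn o a).card ∧
          ((A.filter fun a => ω ∈ Literature.Probability.Percolation.openConn o a).card : ℝ) <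
            (∑ a ∈ A, (Literature.Probability.LatticeModels.prodBernoulli w).real
              (Literature.Probability.Percolation.openConn o a)) / 2} ≤ t)
    {n : ℕ} (w : Sym2 (Fin n) → unitInterval) (A : Finset (Fin n)) (o b : Fin n) (hA : A.card ≤ 5)
    (δ : ℝ) (hδ : 0 ≤ δ)
    (hAb : ∀ a ∈ A, (prodBernoulli w).real (openConn a b : Set (BondConfig (Fin n)))ᶜ ≤ δ) :
    (prodBernoulli w).real {ω : BondConfig (Fin n) |
        1 ≤ (A.filter fun a => ω ∈ openConn o a).card ∧
        ((A.filter fun a => ω ∈ openConn o a).card : ℝ) <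
          (∑ a ∈ A, (prodBernoulli w).real (openConn o a : Set (BondConfig (Fin n)))) / 2} ≤ 2 * δ := by
  have hmeas : ∀ s : Set (BondConfig (Fin n)), MeasurableSet s := fun _ => MeasurableSet.of_discrete
  refine oneCut_card_le_five_of_oneCut5 h5 n w A o (2 * δ) hA (by positivity) ?_
  intro a ha a' ha' _
  have hp := nhlts_pair w a a' b
  have hc : ∀ u v : Fin n, (prodBernoulli w).real (openConn u v : Set (BondConfig (Fin n)))ᶜ =
      1 - (prodBernoulli w).real (openConn u v : Set (BondConfig (Fin n))) :=
    fun u v => probReal_compl_eq_one_sub (hmeas _)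
  have h1 := hAb a ha
  have h2 := hAb a' ha'
  rw [hc] at h1 h2 ⊢
  linarith

/-- **`oneCut(5)` ⟹ linear near-one gluing for every relay set with `|A| ≤ 5`, constant 4**: if `μ(a ↮ b) ≤ δ` for all
`a ∈ A` then `1 − μ(o ↔ b) ≤ (1 − μ(o ↔ A)) + 4δ` (`linearGluing_of_oneCutAt` + `oneCut_card_le_five_of_oneCut5`).
For `|A| ≤ 4` the union bound `gluing_unionBound` is at least as good; the one-cut input matters exactly at `|A| = 5`.
[this work] -/
theorem linearGluing_card_le_five_of_oneCut5
    (h5 : ∀ (n : ℕ) (w : Sym2 (Fin n) → unitInterval) (A : Finset (Fin n)) (o : Fin n) (t : ℝ), A.card = 5 → 0 ≤ t →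
      (∀ a ∈ A, ∀ a' ∈ A, a ≠ a' →
        (Literature.Probability.LatticeModels.prodBernoulli w).real
          (Literature.Probability.Percolation.openConn a a')ᶜ ≤ t) →
      (Literature.Probability.LatticeModels.prodBernoulli w).real
        {ω : Literature.Probability.Percolation.BondConfig (Fin n) |
          1 ≤ (A.filter fun a => ω ∈ Literature.Probability.Percolation.openConn o a).card ∧
          ((A.filter fun a => ω ∈ Literature.Probability.Percolation.openConn o a).card : ℝ) <
            (∑ a ∈ A, (Literature.Probability.LatticeModels.prodBernoulli w).real
              (Literature.Probability.Percolation.openConn o a)) / 2} ≤ t)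
    {n : ℕ} (w : Sym2 (Fin n) → unitInterval) (A : Finset (Fin n)) (o b : Fin n) (hA : A.card ≤ 5)
    (δ : ℝ) (hδ : 0 ≤ δ)
    (hAb : ∀ a ∈ A, (prodBernoulli w).real (openConn a b : Set (BondConfig (Fin n)))ᶜ ≤ δ) :
    1 - (prodBernoulli w).real (openConn o b : Set (BondConfig (Fin n))) ≤
      (1 - (prodBernoulli w).real (⋃ a ∈ A, (openConn o a : Set (BondConfig (Fin n))))) + 4 * δ :=
  linearGluing_of_oneCutAt w A o b δ hδ
    (fun t ht hp => oneCut_card_le_five_of_oneCut5 h5 n w A o t hA ht hp) hAb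

/-! ## The trivial regime: the ε–δ crux statements restricted to `|A| ≤ k` hold unconditionally -/

/-- **`NoHeavyLowerTail` restricted to `A.card ≤ k` is trivially true** (for every `k`): with `δ := ε/(k+1)` the
threshold `δ·E N/ε ≤ k/(k+1) < 1`, so the event `{1 ≤ N < δ·E N/ε}` is EMPTY.  Hence "the crux at `|A| = 5`" is not a
target; only constant-carrying forms are. [this work] -/
theorem noHeavyLowerTail_restricted_card_le (k : ℕ) :
    ∀ ε : ℝ, 0 < ε → ∃ δ : ℝ, 0 < δ ∧ ∀ (n : ℕ) (w : Sym2 (Fin n) → unitInterval) (A : Finset (Fin n)) (o : Fin n),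
      A.card ≤ k →
      1 - δ < (Literature.Probability.LatticeModels.prodBernoulli w).real
        (⋃ a ∈ A, Literature.Probability.Percolation.openConn o a) →
      (∀ a ∈ A, ∀ a' ∈ A, 1 - δ < (Literature.Probability.LatticeModels.prodBernoulli w).real
        (Literature.Probability.Percolation.openConn a a')) →
      (Literature.Probability.LatticeModels.prodBernoulli w).real
        {ω | 1 ≤ (A.filter fun a => ω ∈ Literature.Probability.Percolation.openConn o a).card ∧
          ((A.filter fun a => ω ∈ Literature.Probability.Percolation.openConn o a).card : ℝ) <
            δ * (∑ a ∈ A, (Literature.Probability.LatticeModels.prodBernoulli w).real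
              (Literature.Probability.Percolation.openConn o a)) / ε} < ε := by
  intro ε hε
  refine ⟨ε / (k + 1), by positivity, ?_⟩
  intro n w A o hA _hU _hpair
  set μ := prodBernoulli w with hμ
  have hS : (∑ a ∈ A, μ.real (openConn o a : Set (BondConfig (Fin n)))) ≤ k := by
    calc (∑ a ∈ A, μ.real (openConn o a : Set (BondConfig (Fin n)))) ≤ ∑ _a ∈ A, (1 : ℝ) :=
          Finset.sum_le_sum fun a _ => measureReal_le_one
      _ = (A.card : ℝ) := by simp
      _ ≤ k := by exact_mod_cast hA
  have hthr : ε / (k + 1) * (∑ a ∈ A, μ.real (openConn o a : Set (BondConfig (Fin n)))) / ε < 1 := by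
    have hk : (0 : ℝ) < k + 1 := by positivity
    have h1 : ε / (k + 1) * (∑ a ∈ A, μ.real (openConn o a : Set (BondConfig (Fin n)))) / ε =
        (∑ a ∈ A, μ.real (openConn o a : Set (BondConfig (Fin n)))) / (k + 1) := by
      field_simp
    rw [h1, div_lt_one hk]
    linarith
  have hempty : {ω : BondConfig (Fin n) | 1 ≤ (A.filter fun a => ω ∈ openConn o a).card ∧
      ((A.filter fun a => ω ∈ openConn o a).card : ℝ) <
        ε / (k + 1) * (∑ a ∈ A, μ.real (openConn o a : Set (BondConfig (Fin n)))) / ε} = ∅ := by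
    ext ω
    simp only [Set.mem_setOf_eq, Set.mem_empty_iff_false, iff_false, not_and, not_lt]
    intro h1
    have h1' : (1 : ℝ) ≤ (A.filter fun a => ω ∈ openConn o a).card := by exact_mod_cast h1
    linarith
  rw [hempty, measureReal_empty]
  exact hε

/-- **`NearOneGluing` (Kozma–Nitzan Conjecture 3) restricted to `A.card ≤ k` is trivially true** (for every `k`), by the
union bound `gluing_unionBound` with `δ := ε/(k+1)`.  The whole content of the conjecture is uniformity in `|A|`.
[cite: KozmaNitzan2024, Conjecture 3 (p. 15) — remark on fixed |A|] -/
theorem nearOneGluing_restricted_card_le (k : ℕ) :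
    ∀ ε : ℝ, 0 < ε → ∃ δ : ℝ, 0 < δ ∧ ∀ (n : ℕ) (w : Sym2 (Fin n) → unitInterval) (A : Finset (Fin n)) (o b : Fin n),
      A.card ≤ k →
      1 - δ < (Literature.Probability.LatticeModels.prodBernoulli w).real
        (⋃ a ∈ A, Literature.Probability.Percolation.openConn o a) →
      (∀ a ∈ A, 1 - δ < (Literature.Probability.LatticeModels.prodBernoulli w).real
        (Literature.Probability.Percolation.openConn a b)) →
      1 - ε < (Literature.Probability.LatticeModels.prodBernoulli w).real
        (Literature.Probability.Percolation.openConn o b) := by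
  intro ε hε
  refine ⟨ε / (k + 1), by positivity, ?_⟩
  intro n w A o b hA hU hAb
  set μ := prodBernoulli w with hμ
  have hmeas : ∀ s : Set (BondConfig (Fin n)), MeasurableSet s := fun _ => MeasurableSet.of_discrete
  have hk : (0 : ℝ) < k + 1 := by positivity
  have hAb' : ∀ a ∈ A, μ.real (openConn a b : Set (BondConfig (Fin n)))ᶜ ≤ ε / (k + 1) := by
    intro a ha
    rw [probReal_compl_eq_one_sub (hmeas _)]
    linarith [hAb a ha]
  have hg := gluing_unionBound w A o b (ε / (k + 1)) hAb'
  have hcard : (A.card : ℝ) * (ε / (k + 1)) ≤ k * (ε / (k + 1)) := by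
    have : (A.card : ℝ) ≤ k := by exact_mod_cast hA
    exact mul_le_mul_of_nonneg_right this (by positivity)
  have htot : ε / (k + 1) + k * (ε / (k + 1)) = ε := by
    field_simp
    ring
  linarith

end OneCutDownstream

end Summit.CriticalPhenomena.PercolationContinuityZ3.Theorems

end
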